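import Summits.MatrixMultiplication.OmegaCensus.DicyclicN2Stable
import HarnessLib

/-!
# Parity tools over `V = 𝔽₂³` for dicyclic-law triples with odd-part quotients

ω-census `pub-omega`, family (b3), seat pub-omega-group gen 13.  Framing: lottery ticket; floor = certified bounds/negative
ranges.  VALUE: kernel lemmas for the TPP capacity of dihedral-like groups; NOT progress on ω.

When `A/⟨c₀⟩` is not a `2`-group the odd-weight transfer in `𝔽₂[A/⟨c₀⟩]` of gen 11/12 fails; it survives over the
`2`-group `V = 𝔽₂³` through `Ψ = (ψ₁, ψ₂, ψ₃) : A → V` (three homomorphisms killing `c₀`, jointly onto):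

* `even_fibres_of_periodic_box_odd`: an injective `c₀`-periodic box `{s} + Y + W` with `|Y|` odd has all `π`-fibre counts of
  `W` even, for ANY `π : A →+ B` to a `2`-group with `π c₀ = 0` (gen 12's `periodic_of_periodic_box_odd` minus its last line).
* `fibre_pair_structure`: a `4`-set with even `π`-fibre counts meets one fibre or two (`2+2`); the sign sums
  `∑ (−1)^{ω∘π}` over it are `±4` or `0` according to `ω` on the difference `v` of the two fibre values.
* `sgnSum_eq_card_sub`: `∑_{X} (−1)^{φ} = |X| − 2·#{φ ≠ 0}` (parity of sign sums), and small enumerations in `𝔽₂³`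
  (`f2cube_exists_perp₂`, `f2cube_exists_pair_one'`, `f2cube_two_nsmul`, `f2cube_traceHom_apply`).
Used by `DicyclicN2General.lean` (class N2 for every quotient of `2`-rank `≥ 3`).
-/

namespace Summit.MatrixMultiplication.OmegaCensus

open Literature.Combinatorics.Additive Finset

/-! ## Linear algebra on `V = 𝔽₂³` by enumeration -/

section F2Cube

/-- The trace `v ↦ v₁ + v₂ + v₃` on `𝔽₂³`, as an additive homomorphism. [folklore] -/
theorem f2cube_traceHom_apply (v : ZMod 2 × ZMod 2 × ZMod 2) :
    ((AddMonoidHom.fst (ZMod 2) (ZMod 2 × ZMod 2)) + (AddMonoidHom.fst (ZMod 2) (ZMod 2)).comp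
      (AddMonoidHom.snd (ZMod 2) (ZMod 2 × ZMod 2)) + (AddMonoidHom.snd (ZMod 2) (ZMod 2)).comp
      (AddMonoidHom.snd (ZMod 2) (ZMod 2 × ZMod 2))) v = v.1 + v.2.1 + v.2.2 := rfl

/-- Two vectors of `𝔽₂³` have a common non-zero "orthogonal" vector. [folklore] -/
theorem f2cube_exists_perp₂ (v d : ZMod 2 × ZMod 2 × ZMod 2) :
    ∃ w : ZMod 2 × ZMod 2 × ZMod 2, w ≠ 0 ∧ (w * v).1 + (w * v).2.1 + (w * v).2.2 = 0 ∧
      (w * d).1 + (w * d).2.1 + (w * d).2.2 = 0 := by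
  revert v d; decide

/-- A non-zero `w` pairs to `1` with some vector. [folklore] -/
theorem f2cube_exists_pair_one' (w : ZMod 2 × ZMod 2 × ZMod 2) (hw : w ≠ 0) :
    ∃ z : ZMod 2 × ZMod 2 × ZMod 2, (w * z).1 + (w * z).2.1 + (w * z).2.2 ≠ 0 := by
  revert hw; revert w; decide

/-- `V = 𝔽₂³` is an elementary abelian `2`-group. [folklore] -/
theorem f2cube_two_nsmul (v : ZMod 2 × ZMod 2 × ZMod 2) : (2 ^ 1) • v = 0 := by
  revert v; decide

end F2Cube

/-! ## Sign sums -/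

section Sign

variable {A : Type} [AddCommGroup A] [Fintype A] [DecidableEq A]

omit [Fintype A] [DecidableEq A] in
/-- The sign sum `∑_{a ∈ X} (−1)^{φ a}` equals `|X| − 2·#{a ∈ X : φ a ≠ 0}`; in particular it has the parity of `|X|`.
[folklore] -/
theorem sgnSum_eq_card_sub (φ : A →+ ZMod 2) (X : Finset A) :
    ∑ a ∈ X, (if φ a = 0 then (1 : ℤ) else -1) = X.card - 2 * ((X.filter fun a => φ a ≠ 0).card : ℤ) := by
  rw [Finset.sum_ite, sum_const, sum_const, nsmul_eq_mul, nsmul_eq_mul, mul_one, mul_neg, mul_one]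
  have h := Finset.card_filter_add_card_filter_not (s := X) (fun a => φ a = 0)
  have hcast : ((X.filter fun a => φ a = 0).card : ℤ) + ((X.filter fun a => ¬ φ a = 0).card : ℤ) = X.card := by
    exact_mod_cast h
  simp only [ne_eq]
  linarith

end Sign

/-! ## Even fibres and the pair structure of a `4`-set -/

section Fibres

variable {A : Type} [AddCommGroup A] [Fintype A] [DecidableEq A] {B : Type} [AddCommGroup B] [Fintype B]
  [DecidableEq B]

omit [Fintype A] in
/-- **Even fibres from a periodic box with an odd factor.**  `π : A →+ B` to a `2`-group `B` (`2^m·B = 0`) with `π c₀ = 0`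
(`c₀ ≠ 0`, `2c₀ = 0`); an injective `c₀`-periodic box `{s} + Y + W` with `|Y|` odd.  Then every `π`-fibre count of `W` is
even.  (The proof of gen 12's `periodic_of_periodic_box_odd` up to its last line; no hypothesis on `ker π`.) [folklore] -/
theorem even_fibres_of_periodic_box_odd (π : A →+ B) {c₀ : A} (hπc : π c₀ = 0) (hc₀ : c₀ ≠ 0) (h2c : c₀ + c₀ = 0)
    {m : ℕ} (hB : ∀ b : B, (2 ^ m) • b = 0) {s : A} {Y W : Finset A} (hY : Odd Y.card)
    (hinj : Set.InjOn (fun p : A × A × A => p.1 + p.2.1 + p.2.2) ↑(({s} : Finset A) ×ˢ Y ×ˢ W))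
    (hper : ((({s} : Finset A) ×ˢ Y ×ˢ W).image fun p : A × A × A => p.1 + p.2.1 + p.2.2).image (· + c₀) =
      (({s} : Finset A) ×ˢ Y ×ˢ W).image fun p : A × A × A => p.1 + p.2.1 + p.2.2) :
    ∀ z : B, 2 ∣ (W.filter fun w => π w = z).card := by
  set H : B → ℕ := fun b => (W.filter fun w => π w = b).card with hH
  have hev : ∀ z : B, 2 ∣ ∑ y ∈ Y, H (z - π y) := by
    intro z
    have := even_card_fibre_of_periodic π hπc hc₀ h2c hper (z + π s)
    rw [card_fibre_box_eq_sum π hinj, sum_singleton] at this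
    have e : ∀ y : A, z + π s - π s - π y = z - π y := fun y => by abel
    simpa only [hH, e] using this
  exact even_of_odd_weight_convolution π hB hY H hev

omit [Fintype A] [Fintype B] in
/-- **Pair structure of a `4`-set with even fibre counts.**  If `|U| = 4` and every `π`-fibre count of `U` is even then
`U` meets one fibre (`4` points) or two fibres (`2 + 2`); with `v = 0`, resp. `v` = the difference of the two fibre
values: every `ω : B →+ ZMod 2` with `ω v = 0` is constant on `π(U)` and has sign sum `∑_{u∈U} (−1)^{ω(π u)} = ±4 ≠ 0`,
and every `ω` with `ω v ≠ 0` has sign sum `0`. [folklore] -/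
theorem fibre_pair_structure (π : A →+ B) {U : Finset A} (hU : U.card = 4)
    (hev : ∀ z : B, 2 ∣ (U.filter fun u => π u = z).card) :
    ∃ v : B, (∀ ω : B →+ ZMod 2, ω v = 0 → ∀ u ∈ U, ∀ u' ∈ U, ω (π u) = ω (π u')) ∧
      (∀ ω : B →+ ZMod 2, ω v = 0 → (∑ u ∈ U, (if ω (π u) = 0 then (1 : ℤ) else -1)) ≠ 0) ∧
      (∀ ω : B →+ ZMod 2, ω v ≠ 0 → (∑ u ∈ U, (if ω (π u) = 0 then (1 : ℤ) else -1)) = 0) := by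
  have hne : U.Nonempty := card_pos.1 (by rw [hU]; norm_num)
  obtain ⟨u₀, hu₀⟩ := hne
  set x := π u₀ with hx
  by_cases hall : ∀ u ∈ U, π u = x
  · refine ⟨0, fun ω _ u hu u' hu' => by rw [hall u hu, hall u' hu'], fun ω _ => ?_, fun ω hω => ?_⟩
    · have hconst : ∀ u ∈ U, (if ω (π u) = 0 then (1 : ℤ) else -1) = (if ω x = 0 then (1 : ℤ) else -1) :=
        fun u hu => by rw [hall u hu]
      rw [sum_congr rfl hconst, sum_const, hU, nsmul_eq_mul]
      split_ifs <;> norm_num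
    · exact absurd (map_zero ω) hω
  · push Not at hall
    obtain ⟨u₁, hu₁, hy⟩ := hall
    set y := π u₁ with hydef
    -- the two fibres
    set Fx := U.filter fun u => π u = x with hFx
    set Fy := U.filter fun u => π u = y with hFy
    have hxFx : u₀ ∈ Fx := mem_filter.2 ⟨hu₀, rfl⟩
    have hyFy : u₁ ∈ Fy := mem_filter.2 ⟨hu₁, rfl⟩
    have hdisj : Disjoint Fx Fy := by
      rw [hFx, hFy, disjoint_filter]; intro u _ hux huy; exact hy (huy.symm.trans hux)
    have hFx2 : 2 ≤ Fx.card := by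
      have hdx : 2 ∣ Fx.card := hev x
      obtain ⟨q, hq⟩ := hdx
      have : 0 < Fx.card := card_pos.2 ⟨u₀, hxFx⟩
      omega
    have hFy2 : 2 ≤ Fy.card := by
      have hdy : 2 ∣ Fy.card := hev y
      obtain ⟨q, hq⟩ := hdy
      have : 0 < Fy.card := card_pos.2 ⟨u₁, hyFy⟩
      omega
    have hsub : Fx ∪ Fy ⊆ U := union_subset (filter_subset _ _) (filter_subset _ _)
    have hcard : (Fx ∪ Fy).card = Fx.card + Fy.card := card_union_of_disjoint hdisj
    have hle : (Fx ∪ Fy).card ≤ 4 := hU ▸ card_le_card hsub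
    have hFx' : Fx.card = 2 := by omega
    have hFy' : Fy.card = 2 := by omega
    have hUeq : Fx ∪ Fy = U := eq_of_subset_of_card_le hsub (by rw [hcard, hU]; omega)
    have hmem : ∀ u ∈ U, π u = x ∨ π u = y := by
      intro u hu
      rw [← hUeq, mem_union] at hu
      rcases hu with hu | hu
      · exact Or.inl (mem_filter.1 hu).2
      · exact Or.inr (mem_filter.1 hu).2
    -- the sign sum splits over the two fibres
    have hsplit : ∀ ω : B →+ ZMod 2, (∑ u ∈ U, (if ω (π u) = 0 then (1 : ℤ) else -1)) =
        2 * (if ω x = 0 then (1 : ℤ) else -1) + 2 * (if ω y = 0 then (1 : ℤ) else -1) := by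
      intro ω
      rw [← hUeq, sum_union hdisj]
      have ex : ∀ u ∈ Fx, (if ω (π u) = 0 then (1 : ℤ) else -1) = (if ω x = 0 then (1 : ℤ) else -1) :=
        fun u hu => by rw [(mem_filter.1 hu).2]
      have ey : ∀ u ∈ Fy, (if ω (π u) = 0 then (1 : ℤ) else -1) = (if ω y = 0 then (1 : ℤ) else -1) :=
        fun u hu => by rw [(mem_filter.1 hu).2]
      rw [sum_congr rfl ex, sum_congr rfl ey, sum_const, sum_const, hFx', hFy', nsmul_eq_mul, nsmul_eq_mul]
      push_cast; ring
    refine ⟨y - x, fun ω hω u hu u' hu' => ?_, fun ω hω => ?_, fun ω hω => ?_⟩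
    · rw [map_sub, sub_eq_zero] at hω
      rcases hmem u hu with e | e <;> rcases hmem u' hu' with e' | e' <;> rw [e, e'] <;> simp only [hω]
    · rw [map_sub, sub_eq_zero] at hω
      rw [hsplit ω, hω]
      split_ifs <;> norm_num
    · rw [map_sub] at hω
      have hω' : ω y ≠ ω x := fun h' => hω (by rw [h', sub_self])
      rw [hsplit ω]
      have hx01 : ω x = 0 ∨ ω x = 1 := by generalize ω x = z; revert z; decide
      have hy01 : ω y = 0 ∨ ω y = 1 := by generalize ω y = z; revert z; decide
      rcases hx01 with h0 | h0 <;> rcases hy01 with h1 | h1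
      · exact absurd (h1.trans h0.symm) hω'
      · rw [h0, h1]; norm_num
      · rw [h0, h1]; norm_num
      · exact absurd (h1.trans h0.symm) hω'

end Fibres

end Summit.MatrixMultiplication.OmegaCensus
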